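import Summits.AtomisticToContinuum.HydrodynamicLimit.Theses.MirrorJeffreys
import Summits.AtomisticToContinuum.HydrodynamicLimit.Theorems.LightConeInLaw.Negative.HomogeneousWitness
import Summits.AtomisticToContinuum.HydrodynamicLimit.Theorems.RelayRaceLocalityRestartPrincipleMeanOfGuardedConjunct
import Summits.AtomisticToContinuum.HydrodynamicLimit.Theorems.JaynesSqueezeBlockGibbsToRelEntropyPairings
import Summits.AtomisticToContinuum.HydrodynamicLimit.Theorems.DenseExcursion.Negative.Untied
import Summits.AtomisticToContinuum.HydrodynamicLimit.Theorems.DenseExcursion.Negative.Dichotomy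

/-!
# `ForwardMeanHydro` (stmt-AtomisticToContinuum-17767): load-bearing clauses, non-vacuity, the equilibrium instance

Negative-side / tightness lemmas for the crux `MirrorJeffreys.ForwardMeanHydro` (hydrodynamics IN THE MEAN, forward, in
the dilute band) from the refuter's basic-attack cycle (refuter-rattack-stmt-AtomisticToContinuum-17767-0, 2026-08-17).
Everything is a theorem of the tree (homogeneous gas only; no non-equilibrium dynamics); clause-changed variants of the
crux are INLINED verbatim in the theorem types (no new `def : Prop`):

1. `forwardMeanHydro_iff_noProb` — the hypothesis `∀ N, IsProbabilityMeasure (localGibbsLaw …)` is REDUNDANT (shrink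
   `σ₀ ≤ 1/2`, `isProbabilityMeasure_localGibbsLaw`): a prover may assume or drop it freely.
2. `forwardMeanHydro_frame_inhabited` — NON-VACUITY at every pair of prover-chosen thresholds: for EVERY `η₀ > 0` and
   EVERY `σ₀ > 0` the whole hypothesis frame (a guarded classical solution on the non-empty interval `[0,1)`, Alexander's
   flows, the probability guard, the `t = 0` tie) is inhabited, by the homogeneous gas `(1, 0, 1)` and its constant Euler
   state; no choice of `η₀, σ₀` makes the crux vacuous.
3. `forwardMeanHydro_false_without_tie` — the `t = 0` TIE IS LOAD-BEARING: the crux with the hypothesis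
   `TendstoHydroFieldsAt … 0` deleted (verbatim otherwise) is FALSE — gas `(1,0,1)` against the fictitious constant Euler
   state `(1,0,2)`, pure energy tilt: mean kinetic energy `3/2 ≠ 3`. Any proof must use the tie.
4. `forwardMeanHydro_conclusion_at_equilibrium` — the DEGENERATE instance is TRUE: for the homogeneous gas `(1, u_c, θ_c)`
   the conclusion holds at every time for every continuous combined tilt (invariance of the homogeneous Gibbs law, the
   tree's cluster-expansion LLN, uniform integrability). Constant data are no counterexample.

Tools of independent use (a prover of `HydroLimitForcesForward`, stmt-AtomisticToContinuum-13653, needs exactly these):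
`tilt_eq_fields` (the inline tilt statistic through the three empirical fields), `integral_tilt_eq_fields`,
`macro_tilt_eq_fields`, and `tendsto_meanTilt_of_tendstoHydroFieldsAt` (fields in probability at time `t` under local
Gibbs data ⇒ the mean combined tilt converges, by `tendsto_means_flow_of_tendstoHydroFieldsAt`).
References: C. Kipnis, C. Landim (1999) App. 1 §8; H. Spohn (1991) Part I §2.3, Ch. 3.
-/

noncomputable section

open MeasureTheory Filter Set Topology
open scoped ENNReal InnerProductSpace
open Literature.MathematicalPhysics.KineticTheory Literature.Analysis.FluidPDE
open Summit.AtomisticToContinuum.HydrodynamicLimit.Theses.MirrorJeffreys (ForwardMeanHydro)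

namespace Summit.AtomisticToContinuum.HydrodynamicLimit.Theorems

namespace ForwardMeanHydroNegative

/-! ### 1. The probability hypothesis is redundant -/

/-- The probability hypothesis of `ForwardMeanHydro` is redundant: the crux is equivalent to itself VERBATIM with the
hypothesis `(∀ N, IsProbabilityMeasure (localGibbsLaw σ a₀ u₀ θ₀ N (Φ N))) →` deleted (right-hand side, inlined) — shrink
`σ₀` below `1/2` and use `isProbabilityMeasure_localGibbsLaw`. [folklore] -/
theorem forwardMeanHydro_iff_noProb : ForwardMeanHydro ↔
    (∃ η₀ : ℝ, 0 < η₀ ∧ ∀ (a₀ θ₀ : Literature.MathematicalPhysics.KineticTheory.T3 → ℝ) (u₀ : Literature.MathematicalPhysics.KineticTheory.T3 → Literature.MathematicalPhysics.KineticTheory.V3), Continuous a₀ → Continuous θ₀ → Continuous u₀ → (∀ x, 0 < a₀ x) → (∀ x, 0 < θ₀ x) → ∃ σ₀ : ℝ, 0 < σ₀ ∧ ∀ σ : ℝ, 0 < σ → σ < σ₀ → ∀ (T : ℝ) (ρ θ : ℝ → Literature.MathematicalPhysics.KineticTheory.T3 → ℝ) (u : ℝ → Literature.MathematicalPhysics.KineticTheory.T3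 → Literature.MathematicalPhysics.KineticTheory.V3), Literature.MathematicalPhysics.KineticTheory.IsHardSphereEulerSolution σ T ρ u θ → (∀ t ∈ Set.Ico 0 T, ∀ x, ρ t x * σ ^ 3 < η₀) → ∀ Φ : (N : ℕ) → Literature.Analysis.FluidPDE.HardSphereFlow (Literature.Analysis.FluidPDE.Torus.geometry (Fin 3)) (Literature.MathematicalPhysics.KineticTheory.hsDiameter σ N) (N + 1), Literature.MathematicalPhysics.KineticTheory.TendstoHydroFieldsAt (fun N => Literature.MathematicalPhysics.KineticTheory.localGibbsLaw σ a₀ u₀ θ₀ N (Φ N)) Φ ρ u θ 0 → ∀ t ∈ Set.Ico 0 T, ∀ (lρ le : Literature.MathematicalPhysics.KineticTheory.T3 → ℝ) (lm : Literature.MathematicalPhysics.KineticTheory.T3 → Literature.MathematicalPhysics.KineticTheory.V3), Continuous lρ → Continuous le → Continuous lm → Filter.Tendsto (fun N : ℕ => ∫ z, (∫ y, (lρ y.1 + @inner ℝ _ _ (lm y.1) y.2 + le y.1 * (‖y.2‖ ^ 2 / 2)) ∂Literature.Analysis.FluidPDE.empiricalMeasure ((Φ N).flow t z)) ∂(Literature.MathematicalPhysics.KineticTheory.localGibbsLaw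 σ a₀ u₀ θ₀ N (Φ N))) Filter.atTop (nhds (∫ x, (lρ x * ρ t x + ρ t x * @inner ℝ _ _ (lm x) (u t x) + le x * Literature.MathematicalPhysics.KineticTheory.totalEnergyDensity (ρ t x) (u t x) (θ t x))))) := by
  constructor
  · rintro ⟨η₀, hη₀, H⟩
    refine ⟨η₀, hη₀, fun a₀ θ₀ u₀ ha hθ hu ha0 hθ0 => ?_⟩
    obtain ⟨σ₀, hσ₀, G⟩ := H a₀ θ₀ u₀ ha hθ hu ha0 hθ0
    refine ⟨min σ₀ (1 / 2), lt_min hσ₀ one_half_pos, fun σ hσ hσl T ρ θ u hE hg Φ h0 => ?_⟩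
    exact G σ hσ (hσl.trans_le (min_le_left _ _)) T ρ θ u hE hg Φ
      (fun N => isProbabilityMeasure_localGibbsLaw ha hθ hu ha0 hθ0 (hσl.le.trans (min_le_right _ _)) N (Φ N)) h0
  · rintro ⟨η₀, hη₀, H⟩
    refine ⟨η₀, hη₀, fun a₀ θ₀ u₀ ha hθ hu ha0 hθ0 => ?_⟩
    obtain ⟨σ₀, hσ₀, G⟩ := H a₀ θ₀ u₀ ha hθ hu ha0 hθ0
    exact ⟨σ₀, hσ₀, fun σ hσ hσl T ρ θ u hE hg Φ _ h0 => G σ hσ hσl T ρ θ u hE hg Φ h0⟩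

/-! ### Tools: the homogeneous witness -/

/-- The mean kinetic energy of the homogeneous gas `(1, 0, 1)` tends to `3/2` at every time, for all small `σ`
and every flow family. [folklore] -/
theorem meanEnergy_homogeneous :
    ∃ σ₁ : ℝ, 0 < σ₁ ∧ σ₁ ≤ 1 / 2 ∧ ∀ σ : ℝ, 0 < σ → σ < σ₁ →
      ∀ (Φ : (N : ℕ) → HardSphereFlow (Torus.geometry (Fin 3)) (hsDiameter σ N) (N + 1)) (t : ℝ),
        TendstoHydroFieldsAt (fun N => localGibbsLaw σ (fun _ => 1) (fun _ => 0) (fun _ => 1) N (Φ N)) Φ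
          (fun _ _ => 1) (fun _ _ => 0) (fun _ _ => 1) t ∧
        Tendsto (fun N : ℕ => ∫ z, empiricalEnergyField ((Φ N).flow t z) (fun _ => 1)
          ∂(localGibbsLaw σ (fun _ => 1) (fun _ => 0) (fun _ => 1) N (Φ N))) atTop (𝓝 (3 / 2)) := by
  obtain ⟨σ₁, hσ₁, H⟩ := LightConeInLawNegative.homogeneous_lln_all_times one_pos (0 : V3)
  refine ⟨min σ₁ (1 / 2), lt_min hσ₁ one_half_pos, min_le_right _ _, fun σ hσ hσl Φ t => ?_⟩
  have hσ1 : σ < σ₁ := hσl.trans_le (min_le_left _ _)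
  have hσ2 : σ ≤ 1 / 2 := (hσl.trans_le (min_le_right _ _)).le
  have HL := H σ hσ hσ1 Φ t
  refine ⟨HL, ?_⟩
  have h := (RestartPrinciple.AgeDuhamelForgetting.tendsto_means_flow_of_tendstoHydroFieldsAt
    (a₀ := fun _ => (1 : ℝ)) (θ₀ := fun _ => (1 : ℝ)) (u₀ := fun _ => (0 : V3))
    continuous_const continuous_const continuous_const (fun _ => one_pos) (fun _ => one_pos) hσ2 Φ
    (ρ := fun _ _ => (1 : ℝ)) (θ := fun _ _ => (1 : ℝ)) (u := fun _ _ => (0 : V3)) (t := t)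
    continuous_const continuous_const HL (χ := fun _ => (1 : ℝ)) continuous_const).2.2
  have hval : ∫ x : T3, (fun _ : T3 => (1 : ℝ)) x * totalEnergyDensity 1 0 1 = 3 / 2 := by
    rw [LightConeInLawNegative.integral_one_mul_totalEnergyDensity]; simp
  rwa [hval] at h

/-! ### 2. Non-vacuity: the hypothesis frame is inhabited at every pair of thresholds -/

/-- **Non-vacuity of `ForwardMeanHydro`.** For every `η₀ > 0` and `σ₀ > 0` there are `0 < σ < σ₀`, a classical
guarded solution on the non-empty interval `[0, 1)` (the constant state `(1, 0, 1)`), a flow family, the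
probability guard and the `t = 0` tie — all hypotheses of the crux at once, for the profiles `(1, 0, 1)`. [folklore] -/
theorem forwardMeanHydro_frame_inhabited (η₀ : ℝ) (hη₀ : 0 < η₀) (σ₀ : ℝ) (hσ₀ : 0 < σ₀) :
    ∃ σ : ℝ, 0 < σ ∧ σ < σ₀ ∧ ∃ (T : ℝ) (ρ θ : ℝ → T3 → ℝ) (u : ℝ → T3 → V3),
      IsHardSphereEulerSolution σ T ρ u θ ∧ (∀ t ∈ Ico 0 T, ∀ x, ρ t x * σ ^ 3 < η₀) ∧ (Ico 0 T).Nonempty ∧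
      ∃ Φ : (N : ℕ) → HardSphereFlow (Torus.geometry (Fin 3)) (hsDiameter σ N) (N + 1),
        (∀ N, IsProbabilityMeasure (localGibbsLaw σ (fun _ => 1) (fun _ => 0) (fun _ => 1) N (Φ N))) ∧
        TendstoHydroFieldsAt (fun N => localGibbsLaw σ (fun _ => 1) (fun _ => 0) (fun _ => 1) N (Φ N)) Φ ρ u θ 0 := by
  obtain ⟨σ₁, hσ₁, hσ₁2, H⟩ := meanEnergy_homogeneous
  set σ : ℝ := min (min σ₀ σ₁) (min η₀ 1) / 2 with hσdef
  have hm : 0 < min (min σ₀ σ₁) (min η₀ 1) := by positivity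
  have hσ : 0 < σ := by positivity
  have hlt : σ < min (min σ₀ σ₁) (min η₀ 1) := by rw [hσdef]; linarith
  have hσ0 : σ < σ₀ := hlt.trans_le ((min_le_left _ _).trans (min_le_left _ _))
  have hσ1 : σ < σ₁ := hlt.trans_le ((min_le_left _ _).trans (min_le_right _ _))
  have hση : σ < η₀ := hlt.trans_le ((min_le_right _ _).trans (min_le_left _ _))
  have hσone : σ < 1 := hlt.trans_le ((min_le_right _ _).trans (min_le_right _ _))
  have hσ2 : σ ≤ 1 / 2 := hσ1.le.trans hσ₁2
  obtain ⟨Φ⟩ := DenseExcursionDichotomy.flows_nonempty hσ (hσ1.trans_le hσ₁2)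
  refine ⟨σ, hσ, hσ0, 1, fun _ _ => 1, fun _ _ => 1, fun _ _ => 0,
    DenseExcursionUntied.isHardSphereEulerSolution_const σ 1 0 one_pos one_pos,
    fun t _ x => ?_, ⟨0, le_rfl, one_pos⟩, Φ, fun N => ?_, (H σ hσ hσ1 Φ 0).1⟩
  · have h3 : σ ^ 3 ≤ σ := by
      have : σ ^ 3 = σ * (σ * σ) := by ring
      rw [this]; exact mul_le_of_le_one_right hσ.le (by nlinarith)
    linarith
  · exact isProbabilityMeasure_localGibbsLaw continuous_const continuous_const continuous_const
      (fun _ => one_pos) (fun _ => one_pos) hσ2 N (Φ N)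

/-! ### 3. The `t = 0` tie is load-bearing -/

/-- **The tie is load-bearing**: the crux VERBATIM with the `t = 0` law-of-large-numbers hypothesis
`TendstoHydroFieldsAt (fun N => localGibbsLaw σ a₀ u₀ θ₀ N (Φ N)) Φ ρ u θ 0 →` deleted (inlined) is FALSE. Witness:
profiles `(1, 0, 1)`, the fictitious constant Euler state `(1, 0, 2)` on `[0, 1)` (classical, guarded for
`σ³ < η₀`), Alexander's flows, `t = 0`, the pure energy tilt `(lρ, le, lm) = (0, 1, 0)`: the statement predicts
mean kinetic energy `→ 3`, the homogeneous gas at temperature `1` gives `3/2`. [folklore] -/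
theorem forwardMeanHydro_false_without_tie : ¬
    (∃ η₀ : ℝ, 0 < η₀ ∧ ∀ (a₀ θ₀ : Literature.MathematicalPhysics.KineticTheory.T3 → ℝ) (u₀ : Literature.MathematicalPhysics.KineticTheory.T3 → Literature.MathematicalPhysics.KineticTheory.V3), Continuous a₀ → Continuous θ₀ → Continuous u₀ → (∀ x, 0 < a₀ x) → (∀ x, 0 < θ₀ x) → ∃ σ₀ : ℝ, 0 < σ₀ ∧ ∀ σ : ℝ, 0 < σ → σ < σ₀ → ∀ (T : ℝ) (ρ θ : ℝ → Literature.MathematicalPhysics.KineticTheory.T3 → ℝ) (u : ℝ → Literature.MathematicalPhysics.KineticTheory.T3 → Literature.MathematicalPhysics.KineticTheory.V3), Literature.MathematicalPhysics.KineticTheory.IsHardSphereEulerSolution σ T ρ u θ → (∀ t ∈ Set.Ico 0 T, ∀ x, ρ t x * σ ^ 3 < η₀) → ∀ Φ : (N : ℕ) → Literature.Analysis.FluidPDE.HardSphereFlow (Literature.Analysis.FluidPDE.Torus.geometry (Fin 3)) (Literature.MathematicalPhysics.KineticTheory.hsDiameter σ N) (N + 1), (∀ N, IsProbabilityMeasure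 (Literature.MathematicalPhysics.KineticTheory.localGibbsLaw σ a₀ u₀ θ₀ N (Φ N))) → ∀ t ∈ Set.Ico 0 T, ∀ (lρ le : Literature.MathematicalPhysics.KineticTheory.T3 → ℝ) (lm : Literature.MathematicalPhysics.KineticTheory.T3 → Literature.MathematicalPhysics.KineticTheory.V3), Continuous lρ → Continuous le → Continuous lm → Filter.Tendsto (fun N : ℕ => ∫ z, (∫ y, (lρ y.1 + @inner ℝ _ _ (lm y.1) y.2 + le y.1 * (‖y.2‖ ^ 2 / 2)) ∂Literature.Analysis.FluidPDE.empiricalMeasure ((Φ N).flow t z)) ∂(Literature.MathematicalPhysics.KineticTheory.localGibbsLaw σ a₀ u₀ θ₀ N (Φ N))) Filter.atTop (nhds (∫ x, (lρ x * ρ t x + ρ t x * @inner ℝ _ _ (lm x) (u t x) + le x * Literature.MathematicalPhysics.KineticTheory.totalEnergyDensity (ρ t x) (u t x) (θ t x))))) := by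
  rintro ⟨η₀, hη₀, H⟩
  obtain ⟨σ₀, hσ₀, G⟩ := H (fun _ => 1) (fun _ => 1) (fun _ => 0) continuous_const continuous_const
    continuous_const (fun _ => one_pos) (fun _ => one_pos)
  obtain ⟨σ₁, hσ₁, hσ₁2, M⟩ := meanEnergy_homogeneous
  set σ : ℝ := min (min σ₀ σ₁) (min η₀ 1) / 2 with hσdef
  have hm : 0 < min (min σ₀ σ₁) (min η₀ 1) := by positivity
  have hσ : 0 < σ := by positivity
  have hlt : σ < min (min σ₀ σ₁) (min η₀ 1) := by rw [hσdef]; linarith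
  have hσ0 : σ < σ₀ := hlt.trans_le ((min_le_left _ _).trans (min_le_left _ _))
  have hσ1 : σ < σ₁ := hlt.trans_le ((min_le_left _ _).trans (min_le_right _ _))
  have hση : σ < η₀ := hlt.trans_le ((min_le_right _ _).trans (min_le_left _ _))
  have hσone : σ < 1 := hlt.trans_le ((min_le_right _ _).trans (min_le_right _ _))
  have hσ2 : σ ≤ 1 / 2 := hσ1.le.trans hσ₁2
  obtain ⟨Φ⟩ := DenseExcursionDichotomy.flows_nonempty hσ (hσ1.trans_le hσ₁2)
  have hguard : ∀ t ∈ Ico (0 : ℝ) 1, ∀ x : T3, (fun (_ : ℝ) (_ : T3) => (1 : ℝ)) t x * σ ^ 3 < η₀ := by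
    intro t _ x
    have h3 : σ ^ 3 ≤ σ := by
      have : σ ^ 3 = σ * (σ * σ) := by ring
      rw [this]; exact mul_le_of_le_one_right hσ.le (by nlinarith)
    show 1 * σ ^ 3 < η₀
    linarith
  have hP : ∀ N, IsProbabilityMeasure (localGibbsLaw σ (fun _ => 1) (fun _ => 0) (fun _ => 1) N (Φ N)) :=
    fun N => isProbabilityMeasure_localGibbsLaw continuous_const continuous_const continuous_const
      (fun _ => one_pos) (fun _ => one_pos) hσ2 N (Φ N)
  -- the untied statement against the fictitious state `(1, 0, 2)`, at `t = 0`, energy tilt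
  have h := G σ hσ hσ0 1 (fun _ _ => 1) (fun _ _ => 2) (fun _ _ => 0)
    (DenseExcursionUntied.isHardSphereEulerSolution_const σ 1 0 one_pos two_pos)
    hguard Φ hP 0 ⟨le_rfl, one_pos⟩ (fun _ => 0) (fun _ => 1) (fun _ => 0) continuous_const continuous_const
    continuous_const
  have hlim : ∫ x : T3, ((fun _ : T3 => (0 : ℝ)) x * (fun (_ : ℝ) (_ : T3) => (1 : ℝ)) 0 x +
      (fun (_ : ℝ) (_ : T3) => (1 : ℝ)) 0 x * @inner ℝ _ _ ((fun _ : T3 => (0 : V3)) x) ((fun (_ : ℝ) (_ : T3) => (0 : V3)) 0 x) +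
      (fun _ : T3 => (1 : ℝ)) x * totalEnergyDensity ((fun (_ : ℝ) (_ : T3) => (1 : ℝ)) 0 x)
        ((fun (_ : ℝ) (_ : T3) => (0 : V3)) 0 x) ((fun (_ : ℝ) (_ : T3) => (2 : ℝ)) 0 x)) = 3 := by
    simp [totalEnergyDensity]
  rw [hlim] at h
  -- the same sequence is the mean kinetic energy, which tends to `3/2`
  have h' := (M σ hσ hσ1 Φ 0).2
  have heq : (fun N : ℕ => ∫ z, (∫ y, ((fun _ : T3 => (0 : ℝ)) y.1 + @inner ℝ _ _ ((fun _ : T3 => (0 : V3)) y.1) y.2 +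
      (fun _ : T3 => (1 : ℝ)) y.1 * (‖y.2‖ ^ 2 / 2)) ∂empiricalMeasure ((Φ N).flow 0 z))
        ∂(localGibbsLaw σ (fun _ => 1) (fun _ => 0) (fun _ => 1) N (Φ N))) =
      fun N : ℕ => ∫ z, empiricalEnergyField ((Φ N).flow 0 z) (fun _ => 1)
        ∂(localGibbsLaw σ (fun _ => 1) (fun _ => 0) (fun _ => 1) N (Φ N)) := by
    funext N
    refine integral_congr_ae (ae_of_all _ fun z => ?_)
    simp only [empiricalEnergyField, inner_zero_left, zero_add, add_zero]
  rw [heq] at h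
  have := tendsto_nhds_unique h h'
  norm_num at this

/-! ### Tool: the combined tilt statistic is a combination of the three empirical fields -/

/-- The real inner product on `ℝ³` in coordinates. [folklore] -/
theorem inner_eq_sum_coord (a v : V3) : ⟪a, v⟫_ℝ = ∑ j, a j * v j := by
  rw [PiLp.inner_apply]
  simp [mul_comm]

/-- The inline tilt statistic `⟨ξ, F(z)⟩ = ∫ (ξ_ρ(x) + ⟪ξ_m(x), v⟫ + ξ_e(x)|v|²/2) dμ_z` is the density field of `ξ_ρ`
plus the coordinate momentum fields of the coordinates of `ξ_m` plus the energy field of `ξ_e`. [folklore] -/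
theorem tilt_eq_fields {N : ℕ} (z : Config (N + 1) (Fin 3) T3) (lρ le : T3 → ℝ) (lm : T3 → V3) :
    ∫ y, (lρ y.1 + ⟪lm y.1, y.2⟫_ℝ + le y.1 * (‖y.2‖ ^ 2 / 2)) ∂empiricalMeasure z =
      empiricalDensityField z lρ + ∑ j, empiricalMomentumField z (fun x => lm x j) j +
        empiricalEnergyField z le := by
  rw [integral_empiricalMeasure, empiricalDensityField_eq_sum, empiricalEnergyField_eq_sum]
  simp_rw [empiricalMomentumField_eq_sum, inner_eq_sum_coord]
  simp only [PiLp.smul_apply, WithLp.ofLp_sum, Finset.sum_apply, smul_eq_mul]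
  push_cast
  rw [Finset.sum_add_distrib, Finset.sum_add_distrib, mul_add, mul_add, Finset.sum_comm, Finset.mul_sum,
    Finset.mul_sum, Finset.mul_sum]

/-- **Mean of the combined tilt statistic along a flow = combination of the mean fields** (finite law `P`,
measurable `T`, `P`-integrable kinetic energy of `T z`). [folklore] -/
theorem integral_tilt_eq_fields {N : ℕ} {P : Measure (Config (N + 1) (Fin 3) T3)} [IsFiniteMeasure P]
    {T : Config (N + 1) (Fin 3) T3 → Config (N + 1) (Fin 3) T3} (hT : Measurable T)
    {lρ le : T3 → ℝ} {lm : T3 → V3} (hlρ : Continuous lρ) (hle : Continuous le) (hlm : Continuous lm)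
    (hK : Integrable (fun z => ∫ y, ‖y.2‖ ^ 2 ∂(empiricalMeasure (T z))) P) :
    ∫ z, (∫ y, (lρ y.1 + ⟪lm y.1, y.2⟫_ℝ + le y.1 * (‖y.2‖ ^ 2 / 2)) ∂empiricalMeasure (T z)) ∂P =
      ∫ z, empiricalDensityField (T z) lρ ∂P + ∑ j, ∫ z, empiricalMomentumField (T z) (fun x => lm x j) j ∂P +
        ∫ z, empiricalEnergyField (T z) le ∂P := by
  have hlmj : ∀ j : Fin 3, Continuous fun x => lm x j := fun j =>
    (EuclideanSpace.proj (𝕜 := ℝ) j).continuous.comp hlm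
  have hD := JaynesSqueezeClosure.integrable_empiricalDensityField_comp (P := P) hT hlρ
  have hM := fun j => JaynesSqueezeClosure.integrable_empiricalMomentumField_comp (P := P) hT (hlmj j) hK j
  have hE := JaynesSqueezeClosure.integrable_empiricalEnergyField_comp (P := P) hT hle hK
  have hS : Integrable (fun z => ∑ j, empiricalMomentumField (T z) (fun x => lm x j) j) P :=
    integrable_finsetSum _ fun j _ => hM j
  have hDS : Integrable (fun z => empiricalDensityField (T z) lρ +
      ∑ j, empiricalMomentumField (T z) (fun x => lm x j) j) P := hD.add hS
  simp_rw [tilt_eq_fields]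
  rw [integral_add hDS hE, integral_add hD hS, integral_finsetSum _ fun j _ => hM j]

/-- The macroscopic side: `∫ (ξ_ρ ρ + ρ⟨ξ_m, u⟩ + ξ_e E)` splits the same way (continuous slices on `𝕋³`). [folklore] -/
theorem macro_tilt_eq_fields {R Θ : T3 → ℝ} {U : T3 → V3} (hR : Continuous R) (hU : Continuous U) (hΘ : Continuous Θ)
    {lρ le : T3 → ℝ} {lm : T3 → V3} (hlρ : Continuous lρ) (hle : Continuous le) (hlm : Continuous lm) :
    ∫ x, (lρ x * R x + R x * ⟪lm x, U x⟫_ℝ + le x * totalEnergyDensity (R x) (U x) (Θ x)) =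
      (∫ x, lρ x * R x) + ∑ j, (∫ x, lm x j * R x * U x j) + ∫ x, le x * totalEnergyDensity (R x) (U x) (Θ x) := by
  have hlmj : ∀ j : Fin 3, Continuous fun x => lm x j := fun j =>
    (EuclideanSpace.proj (𝕜 := ℝ) j).continuous.comp hlm
  have hUj : ∀ j : Fin 3, Continuous fun x => U x j := fun j =>
    (EuclideanSpace.proj (𝕜 := ℝ) j).continuous.comp hU
  have hEc : Continuous fun x => totalEnergyDensity (R x) (U x) (Θ x) := by
    unfold totalEnergyDensity; fun_prop
  have i1 : Integrable (fun x => lρ x * R x) := integrable_of_continuous_T3 (hlρ.mul hR)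
  have i2 : ∀ j : Fin 3, Integrable (fun x => lm x j * R x * U x j) := fun j =>
    integrable_of_continuous_T3 (((hlmj j).mul hR).mul (hUj j))
  have i3 : Integrable (fun x => le x * totalEnergyDensity (R x) (U x) (Θ x)) :=
    integrable_of_continuous_T3 (hle.mul hEc)
  have hmid : ∀ x, R x * ⟪lm x, U x⟫_ℝ = ∑ j, lm x j * R x * U x j := fun x => by
    rw [inner_eq_sum_coord, Finset.mul_sum]
    exact Finset.sum_congr rfl fun j _ => by ring
  have iS : Integrable (fun x => ∑ j, lm x j * R x * U x j) := integrable_finsetSum _ fun j _ => i2 j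
  have i1S : Integrable (fun x => lρ x * R x + ∑ j, lm x j * R x * U x j) := i1.add iS
  simp_rw [hmid]
  rw [integral_add i1S i3, integral_add i1 iS, integral_finsetSum _ fun j _ => i2 j]

/-! ### Tool: convergence in probability of the fields ⇒ convergence of the mean combined tilt -/

/-- **From the hydrodynamic fields in probability to the combined tilt in the mean** (local Gibbs data with
continuous profiles, `σ ≤ 1/2`, continuous target slices): uniform integrability
(`tendsto_means_flow_of_tendstoHydroFieldsAt`) plus the splitting of the tilt statistic. This is the content of
the route's necessity certificate `HydroLimitForcesForward` one time slice at a time.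
[cite: KipnisLandim1999, App. 1 §8] -/
theorem tendsto_meanTilt_of_tendstoHydroFieldsAt {σ : ℝ} {a₀ θ₀ : T3 → ℝ} {u₀ : T3 → V3}
    (ha : Continuous a₀) (hθ : Continuous θ₀) (hu : Continuous u₀) (ha0 : ∀ x, 0 < a₀ x) (hθ0 : ∀ x, 0 < θ₀ x)
    (hσ2 : σ ≤ 1 / 2) (Φ : (N : ℕ) → HardSphereFlow (Torus.geometry (Fin 3)) (hsDiameter σ N) (N + 1))
    {ρ θ : ℝ → T3 → ℝ} {u : ℝ → T3 → V3} {t : ℝ} (hρc : Continuous (ρ t)) (huc : Continuous (u t))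
    (hθc : Continuous (θ t))
    (HL : TendstoHydroFieldsAt (fun N => localGibbsLaw σ a₀ u₀ θ₀ N (Φ N)) Φ ρ u θ t)
    {lρ le : T3 → ℝ} {lm : T3 → V3} (hlρ : Continuous lρ) (hle : Continuous le) (hlm : Continuous lm) :
    Tendsto (fun N : ℕ => ∫ z, (∫ y, (lρ y.1 + ⟪lm y.1, y.2⟫_ℝ + le y.1 * (‖y.2‖ ^ 2 / 2))
        ∂empiricalMeasure ((Φ N).flow t z)) ∂(localGibbsLaw σ a₀ u₀ θ₀ N (Φ N))) atTop
      (𝓝 (∫ x, (lρ x * ρ t x + ρ t x * ⟪lm x, u t x⟫_ℝ + le x * totalEnergyDensity (ρ t x) (u t x) (θ t x)))) := by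
  have hlmj : ∀ j : Fin 3, Continuous fun x => lm x j := fun j =>
    (EuclideanSpace.proj (𝕜 := ℝ) j).continuous.comp hlm
  haveI hPI : ∀ N, IsProbabilityMeasure (localGibbsLaw σ a₀ u₀ θ₀ N (Φ N)) := fun N =>
    isProbabilityMeasure_localGibbsLaw ha hθ hu ha0 hθ0 hσ2 N (Φ N)
  -- kinetic energy along the flow is integrable (conservation a.e. + Gaussian statics)
  have hK : ∀ N, Integrable (fun z => ∫ y, ‖y.2‖ ^ 2 ∂(empiricalMeasure ((Φ N).flow t z)))
      (localGibbsLaw σ a₀ u₀ θ₀ N (Φ N)) := by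
    intro N
    have hst := (QuenchedCellClock.integrable_sum_norm_sq_localGibbsLaw ha hθ hu (fun x => (ha0 x).le) hθ0 N
      (Φ N)).const_mul (((N : ℝ) + 1)⁻¹)
    refine hst.congr ?_
    filter_upwards [NearConstantShortTimeHL.sum_norm_sq_vel_flow_ae (Φ N)
      (NearConstantShortTimeHL.particleLaw_absolutelyContinuous (Φ N) _) t] with z hz
    rw [MacroClosureLine.StubLedger.kineticPair_eq_sum, hz]
  have h1 := (RestartPrinciple.AgeDuhamelForgetting.tendsto_means_flow_of_tendstoHydroFieldsAt ha hθ hu ha0 hθ0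
    hσ2 Φ hρc huc HL hlρ).1
  have h2 := fun j => (RestartPrinciple.AgeDuhamelForgetting.tendsto_means_flow_of_tendstoHydroFieldsAt ha hθ hu
    ha0 hθ0 hσ2 Φ hρc huc HL (hlmj j)).2.1 j
  have h3 := (RestartPrinciple.AgeDuhamelForgetting.tendsto_means_flow_of_tendstoHydroFieldsAt ha hθ hu ha0 hθ0
    hσ2 Φ hρc huc HL hle).2.2
  have hsum := (h1.add (tendsto_finsetSum (Finset.univ : Finset (Fin 3)) fun j _ => h2 j)).add h3
  rw [macro_tilt_eq_fields hρc huc hθc hlρ hle hlm]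
  refine hsum.congr fun N => ?_
  exact (integral_tilt_eq_fields ((Φ N).measurable_flow t) hlρ hle hlm (hK N)).symm

/-! ### 4. The degenerate (equilibrium) instance of the conclusion is TRUE -/

/-- **Global equilibrium is no counterexample.** For the homogeneous gas `(1, u_c, θ_c)` and all small `σ`, every
flow family, every time and every continuous combined tilt, the mean tilt statistic converges to its Euler value
at the constant state `(1, u_c, θ_c)` (the classical solution with these data): invariance of the homogeneous
Gibbs law + the tree's cluster-expansion LLN + uniform integrability. [folklore] -/
theorem forwardMeanHydro_conclusion_at_equilibrium {θc : ℝ} (hθc : 0 < θc) (uc : V3) :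
    ∃ σ₁ : ℝ, 0 < σ₁ ∧ ∀ σ : ℝ, 0 < σ → σ < σ₁ →
      ∀ (Φ : (N : ℕ) → HardSphereFlow (Torus.geometry (Fin 3)) (hsDiameter σ N) (N + 1)) (t : ℝ)
        (lρ le : T3 → ℝ) (lm : T3 → V3), Continuous lρ → Continuous le → Continuous lm →
        Tendsto (fun N : ℕ => ∫ z, (∫ y, (lρ y.1 + ⟪lm y.1, y.2⟫_ℝ + le y.1 * (‖y.2‖ ^ 2 / 2))
            ∂empiricalMeasure ((Φ N).flow t z)) ∂(localGibbsLaw σ (fun _ => 1) (fun _ => uc) (fun _ => θc) N (Φ N)))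
          atTop (𝓝 (∫ x, (lρ x * 1 + 1 * ⟪lm x, uc⟫_ℝ + le x * totalEnergyDensity 1 uc θc))) := by
  obtain ⟨σ₁, hσ₁, H⟩ := LightConeInLawNegative.homogeneous_lln_all_times hθc uc
  refine ⟨min σ₁ (1 / 2), lt_min hσ₁ one_half_pos, fun σ hσ hσl Φ t lρ le lm hlρ hle hlm => ?_⟩
  have hσ1 : σ < σ₁ := hσl.trans_le (min_le_left _ _)
  have hσ2 : σ ≤ 1 / 2 := (hσl.trans_le (min_le_right _ _)).le
  exact tendsto_meanTilt_of_tendstoHydroFieldsAt (ρ := fun _ _ => (1 : ℝ)) (θ := fun _ _ => θc)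
    (u := fun _ _ => uc) (t := t) continuous_const continuous_const continuous_const (fun _ => one_pos)
    (fun _ => hθc) hσ2 Φ continuous_const continuous_const continuous_const (H σ hσ hσ1 Φ t) hlρ hle hlm


end ForwardMeanHydroNegative

end Summit.AtomisticToContinuum.HydrodynamicLimit.Theorems

end
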